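import Literature.MathematicalPhysics.QuantumFieldTheory.Balaban1983to89.B16RLeafRecord13LiveCoPR
import Literature.MathematicalPhysics.QuantumFieldTheory.Balaban1983to89.B16RLeafRecord13Sep
import Literature.MathematicalPhysics.QuantumFieldTheory.Balaban1983to89.Node00.Record13SepCoPR

/-!
# `Balaban1983to89.B16RLeafRecord13SepCoPR` — YM-DAG nodes N13∕N11 AT node00-def-T's RECORD 13 v1.6 `CoPR` SEPARATED (7)-REGULAR-RANGE RECORD (`Node00/Record13SepCoP.lean`,
# FILE 24T p521293, KEY-24T; print's ζ-weights `WtOfRecord₁₃R`, print's minimiser background `UbgOfRecord₁₃CoP`, supports `suppOfRecord₁₃SepCoP` reading scale-0 data on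
# the collar): the live-line junction — the CoPR 𝐑-leaf, its law form, the run's `rOperation`, Theorem 1's `densitiesDescribed`, the N11 node `Dag.B14_main`, the (B)-face
# conjunct `B16.Thm1Printed`, the converse `SLaw₁₃CoPR`-side clause — KEYED ON `Provisos₁₃SepCoPR` ∕ `datumOfRecord₁₃SepCoPR` ∕ `IsRecordOfRecord₁₃CSepCoPR`
# ([Balaban1988Convergent] p. 244, Thm 1 p. 262, (2.21) p. 258, (3.24)–(3.25) p. 270; [Balaban1989LargeFieldI] (0.3)–(0.4) p. 176, (i)–(ii) p. 177; [Balaban1989LargeFieldII] Thm 1 p. 355)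

statement-level bookkeeping over published theorems with citation tags; kernel-checked compositions of tree theorems;
nothing here is a claim about the Yang–Mills mass gap.

v1.6 `CoPR` PORT (seat dag-n11-e g9; director-ym LINE №169 RULING H1 on node00-def-T LOCATED-8 = FINDING №8 «the residual 𝐓-weight slot `Stage12Params.Zt` is RUN-BLIND»,
LINE №174 PRESS WORD «pens port their OWN files by token map»): this module is the v1.5 storey `…B16RLeafRecord13SepCoP` (p523930) under node00-def-T's token map T₆ of FILE 25∕26T
(`Node00/Record13CoPR.lean` p529474, `Node00/Record13SepCoPR.lean`; `keymap-CoPR.tsv`): `θ : Stage13Params ↦ θ : Stage13RParams` (`extends Stage13Params`, ONE new field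
`Zr : (p : B12.RunParams) → TkResidualW F N (FluctV N) p.K`), `θ.Zt p.K ↦ θ.Zr p`, `WtOfRecord₁₃P ↦ WtOfRecord₁₃R θ p := tkWeightsOfRecordP … (gOfRecord₁₃ θ.toStage13Params p) (θ.Zr p)`,
`XCoP ↦ XCoPR`, `Provisos₁₃Core ↦ Provisos₁₃CoPR`, `Provisos₁₃SepCoP ↦ Provisos₁₃SepCoPR`; the residual-free objects `densOfRecord₁₃ ∕ tdensOfRecord₁₃ ∕ EOfRecord₁₃ ∕ gOfRecord₁₃ ∕
settingOfRecord₁₃ ∕ suppOfRecord₁₃SepCoP ∕ UbgOfRecord₁₃CoP` are read at `θ.toStage13Params` (the background is NOT re-issued, №176).  The live-line 𝐑-chain reads the 𝐓-weights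
only as the argument `W` of `sect2Slot` ((G6′) `…B16RLeafRecord13LiveGenericW` is `W`-generic), so nothing below depends on `Zr`; the WITNESS faces are stated at EVERY
run-indexed extension `(⟨θ₀, Zr⟩ : Stage13RParams F N)` of a Stage-13 witness `θ₀` (`Zr` a free variable of the section) — node00-def-K0a's cured family
`Stage13RParams.ofCured θ₀ = ⟨θ₀, ZrOfRecord₁₃ F N θ₀⟩` (INTENT-18b) and def-T's run-blind embedding `ofRunBlind θ₀` are instances by `rfl`.  Below, «v1.5 ∕ CoP» in the
inherited prose refers to the objects' origin; every declaration is stated at the v1.6 `CoPR` names.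

WHAT THIS FILE RECORDS (seat dag-n11-e g8, trigger t19 ∕ KEY-24T: node00-def-T's v1.5 `Node00/Record13SepCoP.lean` p521293 — `Provisos₁₃SepCoPR` (row `bg` over print's
minimiser background `UbgOfRecord₁₃CoP` on the separated (7)-regular support `suppOfRecord₁₃SepCoP`; `.toCore` to the UNCHANGED background-free `Provisos₁₃CoPR`; the datum
`datumOfRecord₁₃SepCoPR θ h = datumOfRecord₁₃CoPR θ h.toCore` and the tower by `rfl`, `Node00.datumOfRecord₁₃SepCoPR_eq_coPR`) CARRIES THE ROW `rstep` VERBATIM — the only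
proviso row this lineage's live-line chain reads.  Hence every face of `…B16RLeafRecord13LiveCoPR` (the `(W, U) := (WtOfRecord₁₃R, UbgOfRecord₁₃CoP)` instance of the
`(W, U)`-generic chain `…B16RLeafRecord13LiveGenericW`, p521085) is available to a v1.5 holder FROM `h` ALONE (+ admissibility, the three term-constant signs, the selector
clause) — NO `HasResidualsOfRecord` hypothesis — and the datum faces read at `datumOfRecord₁₃SepCoPR` by name.  This is the (H2) `…B16RLeafRecord13SepCo` text (p520636)
under KEY-23 ∕ KEY-24T, every proof term (H2)'s with `(WtOfRecord₁₃R F N θ p)` inserted before the background argument at the two engine call sites: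
§1  `rstep_of_provisos₁₃SepCoPR`; ★★ `rOpLeaf_VOfRecord₁₃CoPR_of_liveSel_sepCoPR` (N13's CoP conjunct on the live line), `laws₁₃CoPR_of_liveSel_sepCoPR` (the ⁵ knits' `hR` slot at
    v1.5), `rOperation_leavesP_of_liveSel₁₃CoPR_sepCoPR` (worlds bound to `upOfRecord₅C … (θ.toStage5₁₃CoPR)`), `densOfRecord₁₃_succ_ae_eq_tdens_of_liveSel_sepCoPR` (`ρ_{k+1} = 𝐓ρ_k`
    a.e.; background- and weight-free), `sLaw₁₃CoP_all_of_thmP245[LiveSeq]_of_liveSel_sepCoP` (Theorem 1 from (S1ᵀ), resp. from (S1ᵀ) at the `LiveSeq` sequences only — K0a's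
    currency), ★ the converse `slotsT_succ_aeForm_of_sLaw₁₃CoPR_succ_of_liveSel_sepCoPR` and the guard-free clause `sLaw₁₃CoPR_succ_clause_of_Omega_empty_of_liveSel_sepCoPR`.
§2  THE DATUM-LEVEL JUNCTION at `datumOfRecord₁₃SepCoPR F N θ h`: `densitiesDescribed_at_record₁₃SepCoPR_of_laws ∕ _of_liveSel`, the N11 node
    `b14_main_at_record₁₃SepCoPR_of_rOpLeaf ∕ _of_liveSel` (dag-n11-a's `b14_main_at_datumOfTower_of_propTower` at the CoP core and `towerOfRecord₁₃SepCoPR`, start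
    `Node00.sLaw₁₃CoPR_zero`), the K1⁵ binder shape `b14_main_of_isRecordOfRecord₁₃CSepCoPR_datum_of_liveSel` (K1⁵ = `StabilityBAtRecordR13SepCoP`, plan rev 20),
    `thm1Printed_datumOfRecord₁₃SepCoPR_of_laws_of_liveSel` (full (S1ᵀ)), `inductionStep_datumOfRecord₁₃SepCoPR_of_tLawLiveSeq_of_liveSel` ∕
    `thm1Printed_datumOfRecord₁₃SepCoPR_of_lawsLive_of_liveSel` (`LiveSeq` currency) — compositions of node00-def-T's v1.5 faces `sect2Form_stage13SepCoPR_iff`,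
    `inductionBase_datumOfRecord₁₃SepCoPR`, `thm1Printed_datumOfRecord₁₃SepCoPR_of_tLaw_rOpLeaf`, `construction_eq_of_isRecordOfRecord₁₃CSepCoPR` with §1.
§3  at K0a's re-pin `θ.liveRepin₁₃` (selector clause `rfl`); §4 at the witnesses: `theta13LiveOfRecord` (the CoP leaf is the CLOSED theorem
    `…LiveCoP.rOpLeaf_VOfRecord₁₃CoPR_theta13LiveOfRecord`, so `b14_main_at_record₁₃SepCoPR_theta13LiveOfRecord` needs (S1ᵀ) and NOTHING ELSE), `theta13OfThm1CC1` (K0a's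
    C¹-route family; six signs), `theta13LiveOfNumerics` (`n.Pos`, `0 < ε₂₉`, signs).
§6  the `IsRecordOfRecord₁₃CSepCoPR`-keyed (D, w)-face `densitiesDescribed_of_isRecordOfRecord₁₃CSepCoPR_of_rOperation`.
§8  N11's per-level share ON PRINT'S RANGE at v1.5 `CoP`: `sLaw₁₃CoPR_succ_of_tLawLiveSep_of_liveSel_sepCoPR` ∕ `sLaw₁₃CoPR_all_of_thmP245LiveSep_of_liveSel_sepCoPR` — the §2
    dichotomy of `𝐓ρ_k`'s slots demanded only at LIVE ∧ `Sect2.SeqSeparated` sequences (`0 < M₁ ≤ M`; live ⇒ separated is the background-free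
    `…B16RLeafRecord13Sep.seqSeparated_of_liveSeq₁₃`).
§7  ★★ the converse node faces from `h`'s row `rstep`: `densitiesDescribed_leavesP_iff_sLaw₁₃CoPR_all_sepCoPR`, `sLaw₁₃CoPR_succ_clause_of_Omega_empty_of_densitiesDescribed_of_liveSel_sepCoPR`
    (generic `θ`, selector clause only), ★★★ `…_of_densitiesDescribed_theta13LiveOfRecord_sepCoP` ∕ `…_of_b14_main_theta13LiveOfRecord_sepCoP` (no further hypothesis).
(Director-ym LINE №160 (5) «landed Co∕SepCo storeys STAND; CoP twins are generator∕token work»: the engine is `…LiveGenericW`; what this file adds over `…LiveCoP` is the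
discharge of the chain's `rstep` input by `h.rstep` and the v1.5 SepCoP names — v1.2 ∕ v1.3 ∕ v1.4 (`…B16RLeafRecord13Sep` ∕ `…SepMixed` ∕ `…SepCo`) have no bridge to v1.5,
node00-def-T KEY-24T.)

HONEST SCOPE: on the live line 𝐑 of record integrates out only terms of zero fibre mass ([I] p. 177 (i)–(ii)); [B16] Theorem 1's 𝐑-construction is NOT exercised;
(S1ᵀ) (N11's analysis, [III] §3) and `Provisos₁₃SepCoPR` (K0⁵) are HYPOTHESES — whether (S1ᵀ)'s first instance holds at v1.5 `CoP` on the live line is seat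
dag-n11-d's re-based kernel chain, not this file; nothing of Bałaban is asserted; count-neutral.
-/

noncomputable section

open MeasureTheory
open scoped BigOperators Matrix.Norms.L2Operator

namespace Literature.MathematicalPhysics.QuantumFieldTheory.Balaban1983to89.B16RLeafRecord13SepCoPR

open T4Continuum T4DatumAssembly Node00 B14.Eq218Concrete DagBinding
open B16RLeafRecord11 B16RLeafRecord12 B16RLeafRecord12Live B16RLeafRecord12AtLive
open B16RLeafRecord13Live B16RLeafRecord13AtLive B16RLeafRecord13LiveRstep B16RLeafRecord13LiveGenericW B16RLeafRecord13LiveCoPR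
open B14NodeKnitTowerDatum (densitiesDescribed_iff_core b14_main_at_datumOfTower_of_propTower)

variable (F : T4Family) (N : ℕ) [NeZero N]

/-! ## §1  The live-line chain from `h : θ.Provisos₁₃SepCoPR F N` (one projection: row `rstep`) -/

section Leaf

variable (θ : Stage13RParams F N) (p : B12.RunParams)

variable {F N θ} in
/-- **`Provisos₁₃SepCoPR` carries the row `rstep`** (verbatim field; the only row the live-line chain reads). [cite: Balaban1989LargeFieldI, (0.3) p.176 (bookkeeping)] -/
theorem rstep_of_provisos₁₃SepCoPR (h : θ.Provisos₁₃SepCoPR F N) :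
    ∀ (p : B12.RunParams) (k : ℕ) [DecidableEq (PBond (F.P p.K) (k + 1))], k < p.K →
      (towerRepOfRecord F N θ.ν θ.τ9 (slotsTOfRecord F N θ.ν θ.τ9 (EOfRecord₁₃ F N θ.toStage13Params) (wOfRecord₉ F N θ.toStage9Params) θ.ppSel)
        θ.ppSel p (gOfRecord₁₃ F N θ.toStage13Params p) (k + 1)).toRepData.ProvisosInt :=
  fun p k _ hk => h.rstep p k hk

/-- **★ THE 𝐑-LEAF OF RECORD AT THE LIVE SELECTOR FROM `Provisos₁₃SepCoPR`, ADMISSIBILITY AND THE SIGNS.** [cite: Balaban1988Convergent, p.244, Thm 2 p.263; Balaban1989LargeFieldI, (0.3) p.176, p.177 (i)–(ii); Balaban1989LargeFieldII, Thm 1 p.355 (not exercised)] -/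
theorem rOpLeaf_VOfRecord₁₃CoPR_of_liveSel_sepCoPR (h : θ.Provisos₁₃SepCoPR F N) (hθ : θ.Admissible F N) (hκ : 0 ≤ θ.s2.lf.κ) (hE₀ : 0 ≤ θ.s2.lf.E₀)
    (hB₀ : 0 ≤ θ.s2.lf.B₀) (hsel : θ.ppSel = ppSelLiveOfRecord F N θ.ν θ.τ9 (EOfRecord₁₃ F N θ.toStage13Params) (wOfRecord₉ F N θ.toStage9Params)) :
    ROpLeaf (VOfRecord₁₃CoPR F N θ p) :=
  rOpLeaf_VOfRecord₁₃CoPR_of_liveSel_of_rstep F N θ p (rstep_of_provisos₁₃SepCoPR h) hθ hκ hE₀ hB₀ hsel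

/-- **The (R₁₃) slot in law form at the live selector from `Provisos₁₃SepCoPR`** (`hR13` ∕ `rRow` of the Stage-13 knits). [cite: Balaban1988Convergent, p.244 (bookkeeping); Balaban1989LargeFieldII, Thm 1 p.355 (not exercised)] -/
theorem laws₁₃CoPR_of_liveSel_sepCoPR (h : θ.Provisos₁₃SepCoPR F N) (hθ : θ.Admissible F N) (hκ : 0 ≤ θ.s2.lf.κ) (hE₀ : 0 ≤ θ.s2.lf.E₀) (hB₀ : 0 ≤ θ.s2.lf.B₀)
    (hsel : θ.ppSel = ppSelLiveOfRecord F N θ.ν θ.τ9 (EOfRecord₁₃ F N θ.toStage13Params) (wOfRecord₉ F N θ.toStage9Params)) :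
    ∀ k, k < p.K → TLaw₁₃CoPR F N θ p k → SLaw₁₃CoPR F N θ p (k + 1) :=
  laws₁₃CoPR_of_liveSel_of_rstep F N θ p (rstep_of_provisos₁₃SepCoPR h) hθ hκ hE₀ hB₀ hsel

/-- **The run's `rOperation` leaf reads TRUE at a world bound to the C-binding of record over the Stage-13 view, at the live selector, from `Provisos₁₃SepCoPR`.**
[cite: Balaban1988Convergent, p.244; Balaban1989LargeFieldII, Thm 1 p.355 (bookkeeping at the record)] -/
theorem rOperation_leavesP_of_liveSel₁₃CoPR_sepCoPR (w : WorldP) (hup : w.up p = upOfRecord₅C F N (θ.toStage5₁₃CoPR F N) p) (h : θ.Provisos₁₃SepCoPR F N)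
    (hθ : θ.Admissible F N) (hκ : 0 ≤ θ.s2.lf.κ) (hE₀ : 0 ≤ θ.s2.lf.E₀) (hB₀ : 0 ≤ θ.s2.lf.B₀)
    (hsel : θ.ppSel = ppSelLiveOfRecord F N θ.ν θ.τ9 (EOfRecord₁₃ F N θ.toStage13Params) (wOfRecord₉ F N θ.toStage9Params)) :
    (leavesP w p).rOperation :=
  rOperation_leavesP_of_liveSel₁₃CoPR_of_rstep F N θ p w hup (rstep_of_provisos₁₃SepCoPR h) hθ hκ hE₀ hB₀ hsel

/-- **★ AT THE LIVE SELECTOR, `ρ_{k+1} = 𝐓ρ_k` ALMOST EVERYWHERE from `Provisos₁₃SepCoPR`**, `k < K`. [cite: Balaban1989LargeFieldI, (0.2)–(0.4) p.176, p.177 (i)–(ii); Balaban1988Convergent, (2.18) p.257, (3.24)–(3.25) p.270] -/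
theorem densOfRecord₁₃_succ_ae_eq_tdens_of_liveSel_sepCoPR (h : θ.Provisos₁₃SepCoPR F N)
    (hsel : θ.ppSel = ppSelLiveOfRecord F N θ.ν θ.τ9 (EOfRecord₁₃ F N θ.toStage13Params) (wOfRecord₉ F N θ.toStage9Params)) (k : ℕ) (hk : k < p.K) :
    densOfRecord₁₃ F N θ.toStage13Params p (k + 1) =ᵐ[fieldMeasure (F.P p.K) (k + 1) (SU N)] tdensOfRecord₁₃ F N θ.toStage13Params p k :=
  densOfRecord₁₃_succ_ae_eq_tdens_of_liveSel_of_rstep F N θ.toStage13Params p (rstep_of_provisos₁₃SepCoPR h) hsel k hk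

/-- **★ THEOREM 1 [III] AT THE LIVE SELECTOR FROM (S1ᵀ) AT THE `LiveSeq` SEQUENCES ONLY, from `Provisos₁₃SepCoPR`.** [cite: Balaban1988Convergent, Thm 1 p.262; Theorem p.245; p.244; Balaban1989LargeFieldI, (0.3) p.176, p.177 (i)–(ii)] -/
theorem sLaw₁₃CoPR_all_of_thmP245LiveSeq_of_liveSel_sepCoPR (h : θ.Provisos₁₃SepCoPR F N) (hθ : θ.Admissible F N) (hκ : 0 ≤ θ.s2.lf.κ) (hE₀ : 0 ≤ θ.s2.lf.E₀)
    (hB₀ : 0 ≤ θ.s2.lf.B₀) (hsel : θ.ppSel = ppSelLiveOfRecord F N θ.ν θ.τ9 (EOfRecord₁₃ F N θ.toStage13Params) (wOfRecord₉ F N θ.toStage9Params))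
    (hT : ∀ k, k < p.K → SLaw₁₃CoPR F N θ p k →
      ∃ (t : SeqOfRecord F θ.ν θ.τ9.M (gOfRecord₁₃ F N θ.toStage13Params p) p.K (k + 1) → Sect2.TermValues (F.P p.K) (MatA N) (FluctV N) θ.τ9.M)
      (Ek : SeqOfRecord F θ.ν θ.τ9.M (gOfRecord₁₃ F N θ.toStage13Params p) p.K (k + 1) → ℝ), Sect2.UniversalE t ∧
      ∀ s, Sect2.LawsT (sect2TowerOfRecord F N (FluctV N) p.K (settingOfRecord₁₃ F N θ.toStage13Params p) (θ.Rz p.K) s (t s)) (settingOfRecord₁₃ F N θ.toStage13Params p).lf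
          (settingOfRecord₁₃ F N θ.toStage13Params p).βc k ∧
        (LiveSeq F N θ.ν θ.τ9 p (gOfRecord₁₃ F N θ.toStage13Params p) (k + 1)
            (slotsTOfRecord F N θ.ν θ.τ9 (EOfRecord₁₃ F N θ.toStage13Params) (wOfRecord₉ F N θ.toStage9Params) θ.ppSel p (gOfRecord₁₃ F N θ.toStage13Params p) (k + 1)) s →
          (slotsTOfRecord F N θ.ν θ.τ9 (EOfRecord₁₃ F N θ.toStage13Params) (wOfRecord₉ F N θ.toStage9Params) θ.ppSel p (gOfRecord₁₃ F N θ.toStage13Params p) (k + 1) s = 0 ∨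
            ∀ᵐ V ∂(fieldMeasure (F.P p.K) (k + 1) (SU N)), chiSeqOfRecord F N θ.ν θ.τ9.M (gOfRecord₁₃ F N θ.toStage13Params p) p.K (k + 1) s V ≠ 0 →
              slotsTOfRecord F N θ.ν θ.τ9 (EOfRecord₁₃ F N θ.toStage13Params) (wOfRecord₉ F N θ.toStage9Params) θ.ppSel p (gOfRecord₁₃ F N θ.toStage13Params p) (k + 1) s V
                = sect2Slot F N (FluctV N) p.K (settingOfRecord₁₃ F N θ.toStage13Params p) (θ.Rz p.K) (WtOfRecord₁₃R F N θ p) s (t s) (Ek s)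
                    (UbgOfRecord₁₃CoP F N θ.toStage13Params p (k + 1) s) V))) :
    ∀ k, k ≤ p.K → SLaw₁₃CoPR F N θ p k :=
  sLaw₁₃CoPR_all_of_thmP245LiveSeq_of_liveSel_of_rstep F N θ p (rstep_of_provisos₁₃SepCoPR h) hθ hκ hE₀ hB₀ hsel hT

/-- **THEOREM 1 [III] AT THE LIVE SELECTOR FROM THE FULL (S1ᵀ), from `Provisos₁₃SepCoPR`.** [cite: Balaban1988Convergent, Thm 1 p.262; Theorem p.245; p.244] -/
theorem sLaw₁₃CoPR_all_of_thmP245_of_liveSel_sepCoPR (h : θ.Provisos₁₃SepCoPR F N) (hθ : θ.Admissible F N) (hκ : 0 ≤ θ.s2.lf.κ) (hE₀ : 0 ≤ θ.s2.lf.E₀)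
    (hB₀ : 0 ≤ θ.s2.lf.B₀) (hsel : θ.ppSel = ppSelLiveOfRecord F N θ.ν θ.τ9 (EOfRecord₁₃ F N θ.toStage13Params) (wOfRecord₉ F N θ.toStage9Params))
    (hT : ∀ k, k < p.K → SLaw₁₃CoPR F N θ p k → TLaw₁₃CoPR F N θ p k) :
    ∀ k, k ≤ p.K → SLaw₁₃CoPR F N θ p k :=
  sLaw₁₃CoPR_all_of_thmP245_of_liveSel_of_rstep F N θ p (rstep_of_provisos₁₃SepCoPR h) hθ hκ hE₀ hB₀ hsel hT

/-- **★ THE CONVERSE AT v1.5 `CoP` from `Provisos₁₃SepCoPR`'s row `rstep`**: `SLaw₁₃CoPR θ p (k+1)` ⇒ the a.e. two-branch 𝐓-form of `slotT_{k+1}` (weights `WtOfRecord₁₃R`, background `UbgOfRecord₁₃CoP`)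
(live selector; NO admissibility, NO sign, NO residual hypothesis). [cite: Balaban1988Convergent, (2.17)–(2.18) p.257, Thm 1 p.262, (3.24)–(3.25) p.270; Balaban1989LargeFieldI, (0.3) p.176, p.177 (i)–(ii)] -/
theorem slotsT_succ_aeForm_of_sLaw₁₃CoPR_succ_of_liveSel_sepCoPR (h : θ.Provisos₁₃SepCoPR F N)
    (hsel : θ.ppSel = ppSelLiveOfRecord F N θ.ν θ.τ9 (EOfRecord₁₃ F N θ.toStage13Params) (wOfRecord₉ F N θ.toStage9Params)) (k : ℕ) (hk : k < p.K)
    (hS : SLaw₁₃CoPR F N θ p (k + 1)) :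
    ∃ (t : SeqOfRecord F θ.ν θ.τ9.M (gOfRecord₁₃ F N θ.toStage13Params p) p.K (k + 1) → Sect2.TermValues (F.P p.K) (MatA N) (FluctV N) θ.τ9.M)
      (Ek : SeqOfRecord F θ.ν θ.τ9.M (gOfRecord₁₃ F N θ.toStage13Params p) p.K (k + 1) → ℝ), Sect2.UniversalE t ∧
      ∀ s, Sect2.LawsRT (sect2TowerOfRecord F N (FluctV N) p.K (settingOfRecord₁₃ F N θ.toStage13Params p) (θ.Rz p.K) s (t s)) (settingOfRecord₁₃ F N θ.toStage13Params p).lf (k + 1) ∧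
        ((∀ᵐ V ∂(fieldMeasure (F.P p.K) (k + 1) (SU N)), chiSeqOfRecord F N θ.ν θ.τ9.M (gOfRecord₁₃ F N θ.toStage13Params p) p.K (k + 1) s V ≠ 0 →
            slotsTOfRecord F N θ.ν θ.τ9 (EOfRecord₁₃ F N θ.toStage13Params) (wOfRecord₉ F N θ.toStage9Params) θ.ppSel p (gOfRecord₁₃ F N θ.toStage13Params p) (k + 1) s V = 0) ∨
          ∀ᵐ V ∂(fieldMeasure (F.P p.K) (k + 1) (SU N)), chiSeqOfRecord F N θ.ν θ.τ9.M (gOfRecord₁₃ F N θ.toStage13Params p) p.K (k + 1) s V ≠ 0 →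
            slotsTOfRecord F N θ.ν θ.τ9 (EOfRecord₁₃ F N θ.toStage13Params) (wOfRecord₉ F N θ.toStage9Params) θ.ppSel p (gOfRecord₁₃ F N θ.toStage13Params p) (k + 1) s V
              = sect2Slot F N (FluctV N) p.K (settingOfRecord₁₃ F N θ.toStage13Params p) (θ.Rz p.K) (WtOfRecord₁₃R F N θ p) s (t s) (Ek s)
                  (UbgOfRecord₁₃CoP F N θ.toStage13Params p (k + 1) s) V) :=
  slotsT_succ_aeForm_of_sLaw₁₃CoPR_succ_of_liveSel_of_rstep F N θ p (rstep_of_provisos₁₃SepCoPR h) hsel k hk hS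

/-- **The `SLaw₁₃CoPR`-side guard-free clause at a no-expansion sequence** (`Ω_{k+1}(s′) = ∅`) from `Provisos₁₃SepCoPR`'s row `rstep` at the live selector.
[cite: Balaban1988Convergent, (3.25) p.270, remark p.262, Theorem p.245; Balaban1989LargeFieldI, (0.3) p.176] -/
theorem sLaw₁₃CoPR_succ_clause_of_Omega_empty_of_liveSel_sepCoPR (h : θ.Provisos₁₃SepCoPR F N)
    (hsel : θ.ppSel = ppSelLiveOfRecord F N θ.ν θ.τ9 (EOfRecord₁₃ F N θ.toStage13Params) (wOfRecord₉ F N θ.toStage9Params)) {k : ℕ} (hk : k < p.K)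
    (hS : SLaw₁₃CoPR F N θ p (k + 1)) (s : SeqOfRecord F θ.ν θ.τ9.M (gOfRecord₁₃ F N θ.toStage13Params p) p.K (k + 1)) (hΩ : s.Ω (k + 1) = ∅) :
    ∃ (t : SeqOfRecord F θ.ν θ.τ9.M (gOfRecord₁₃ F N θ.toStage13Params p) p.K (k + 1) → Sect2.TermValues (F.P p.K) (MatA N) (FluctV N) θ.τ9.M)
      (Ek : SeqOfRecord F θ.ν θ.τ9.M (gOfRecord₁₃ F N θ.toStage13Params p) p.K (k + 1) → ℝ),
      Sect2.UniversalE t ∧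
      (∀ s', Sect2.LawsRT (sect2TowerOfRecord F N (FluctV N) p.K (settingOfRecord₁₃ F N θ.toStage13Params p) (θ.Rz p.K) s' (t s')) (settingOfRecord₁₃ F N θ.toStage13Params p).lf (k + 1)) ∧
      ((slotsTOfRecord F N θ.ν θ.τ9 (EOfRecord₁₃ F N θ.toStage13Params) (wOfRecord₉ F N θ.toStage9Params) θ.ppSel p (gOfRecord₁₃ F N θ.toStage13Params p) (k + 1) s
          =ᵐ[fieldMeasure (F.P p.K) (k + 1) (SU N)] 0) ∨
        ∀ᵐ V' ∂fieldMeasure (F.P p.K) (k + 1) (SU N),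
          slotsTOfRecord F N θ.ν θ.τ9 (EOfRecord₁₃ F N θ.toStage13Params) (wOfRecord₉ F N θ.toStage9Params) θ.ppSel p (gOfRecord₁₃ F N θ.toStage13Params p) (k + 1) s V' =
            sect2Slot F N (FluctV N) p.K (settingOfRecord₁₃ F N θ.toStage13Params p) (θ.Rz p.K) (WtOfRecord₁₃R F N θ p) s (t s) (Ek s) (UbgOfRecord₁₃CoP F N θ.toStage13Params p (k + 1) s) V') :=
  sLaw₁₃CoPR_succ_clause_of_Omega_empty_of_liveSel_of_rstep F N θ p (rstep_of_provisos₁₃SepCoPR h) hsel hk hS s hΩ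

end Leaf

/-! ## §2  THE DATUM-LEVEL JUNCTION at `datumOfRecord₁₃SepCoPR F N θ h` -/

section Junction

variable (θ : Stage13RParams F N) (p : B12.RunParams) (w : WorldP) (h : θ.Provisos₁₃SepCoPR F N)

/-- **Theorem 1's conclusion `densitiesDescribed` AT A v1.5 STAGE-13 WORLD FROM THE TWO LAW SLOTS** (core unchanged: `densitiesDescribed_iff_core` at `towerOfRecord₁₃SepCoPR`).
[cite: Balaban1988Convergent, Thm 1 p.262; Theorem p.245; p.244] -/
theorem densitiesDescribed_at_record₁₃SepCoPR_of_laws (hC : w.C = (datumOfRecord₁₃SepCoPR F N θ h).C)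
    (hR : ∀ k, k < p.K → TLaw₁₃CoPR F N θ p k → SLaw₁₃CoPR F N θ p (k + 1)) (hT : ∀ k, k < p.K → SLaw₁₃CoPR F N θ p k → TLaw₁₃CoPR F N θ p k) :
    (leavesP w p).densitiesDescribed :=
  (densitiesDescribed_iff_core F N (coreOfRecord₁₃CoPR F N θ) (towerOfRecord₁₃SepCoPR F N θ h) w p hC).2 (sLaw₁₃CoPR_all_of_laws F N θ p hR hT)

/-- **`densitiesDescribed` AT A v1.5 STAGE-13 WORLD AT THE LIVE SELECTOR FROM (S1ᵀ) ALONE** (the 𝐑-slot supplied). [cite: Balaban1988Convergent, Thm 1 p.262; Theorem p.245; p.244] -/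
theorem densitiesDescribed_at_record₁₃SepCoPR_of_liveSel (hC : w.C = (datumOfRecord₁₃SepCoPR F N θ h).C) (hθ : θ.Admissible F N) (hκ : 0 ≤ θ.s2.lf.κ)
    (hE₀ : 0 ≤ θ.s2.lf.E₀) (hB₀ : 0 ≤ θ.s2.lf.B₀)
    (hsel : θ.ppSel = ppSelLiveOfRecord F N θ.ν θ.τ9 (EOfRecord₁₃ F N θ.toStage13Params) (wOfRecord₉ F N θ.toStage9Params))
    (hT : ∀ k, k < p.K → SLaw₁₃CoPR F N θ p k → TLaw₁₃CoPR F N θ p k) : (leavesP w p).densitiesDescribed :=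
  densitiesDescribed_at_record₁₃SepCoPR_of_laws F N θ p w h hC (laws₁₃CoPR_of_liveSel_sepCoPR F N θ p h hθ hκ hE₀ hB₀ hsel) hT

/-- **N11 · `Dag.B14_main (leavesP w P)` AT A v1.5 STAGE-13 WORLD, 𝐑 READ THROUGH THE LEAF, ONE DISPLAYED SLOT (S1ᵀ)** (n11-a's `b14_main_at_datumOfTower_of_propTower` at the
Stage-13 core and `towerOfRecord₁₃SepCoPR`; START `sLaw₁₃CoPR_zero`). [cite: Balaban1988Convergent, Thm 1 p.262; Theorem p.245; p.244] -/
theorem b14_main_at_record₁₃SepCoPR_of_rOpLeaf (hC : w.C = (datumOfRecord₁₃SepCoPR F N θ h).C)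
    (hV : (leavesP w p).rOperation → ROpLeaf (VOfRecord₁₃CoPR F N θ p))
    (hT : (leavesP w p).b7 → (leavesP w p).b8 → (leavesP w p).b9 → (leavesP w p).b10 → (leavesP w p).b11 →
      (leavesP w p).smallCouplings → (leavesP w p).smallFieldInductive → (leavesP w p).flowControl →
        ∀ k, k < p.K → SLaw₁₃CoPR F N θ p k → TLaw₁₃CoPR F N θ p k) :
    Dag.B14_main (leavesP w p) :=
  b14_main_at_datumOfTower_of_propTower F N (coreOfRecord₁₃CoPR F N θ) (towerOfRecord₁₃SepCoPR F N θ h) w p hC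
    (SLaw₁₃CoPR F N θ p) (TLaw₁₃CoPR F N θ p) (fun _ _ hS => hS) (fun _ => sLaw₁₃CoPR_zero F N θ p) hT
    (fun hrop => (rOpLeaf_VOfRecord₁₃CoPR_iff F N θ p).1 (hV hrop))

/-- **N11 · `Dag.B14_main (leavesP w P)` AT A v1.5 STAGE-13 WORLD AT THE LIVE SELECTOR — ONE DISPLAYED SLOT (S1ᵀ), NO 𝐑-READING HYPOTHESIS.**
[cite: Balaban1988Convergent, Thm 1 p.262; Theorem p.245; p.244; (2.6) p.255] -/
theorem b14_main_at_record₁₃SepCoPR_of_liveSel (hC : w.C = (datumOfRecord₁₃SepCoPR F N θ h).C) (hθ : θ.Admissible F N) (hκ : 0 ≤ θ.s2.lf.κ)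
    (hE₀ : 0 ≤ θ.s2.lf.E₀) (hB₀ : 0 ≤ θ.s2.lf.B₀)
    (hsel : θ.ppSel = ppSelLiveOfRecord F N θ.ν θ.τ9 (EOfRecord₁₃ F N θ.toStage13Params) (wOfRecord₉ F N θ.toStage9Params))
    (hT : (leavesP w p).b7 → (leavesP w p).b8 → (leavesP w p).b9 → (leavesP w p).b10 → (leavesP w p).b11 →
      (leavesP w p).smallCouplings → (leavesP w p).smallFieldInductive → (leavesP w p).flowControl →
        ∀ k, k < p.K → SLaw₁₃CoPR F N θ p k → TLaw₁₃CoPR F N θ p k) :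
    Dag.B14_main (leavesP w p) :=
  b14_main_at_record₁₃SepCoPR_of_rOpLeaf F N θ p w h hC (fun _ => rOpLeaf_VOfRecord₁₃CoPR_of_liveSel_sepCoPR F N θ p h hθ hκ hE₀ hB₀ hsel) hT

/-- **N11 IN THE BINDER SHAPE OF THE rev-20 K1-class stub** (a world with `IsRecordOfRecord₁₃CSepCoPR F N (datumOfRecord₁₃SepCoPR F N θ h) w` at an EXPLICIT `(θ, h)` carrying the
selector clause): the N11 conjunct at every run from (S1ᵀ) alone (+ signs). [cite: Balaban1988Convergent, Thm 1 p.262; Theorem p.245; p.244 (bookkeeping at the record)] -/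
theorem b14_main_of_isRecordOfRecord₁₃CSepCoPR_datum_of_liveSel (hrec : IsRecordOfRecord₁₃CSepCoPR F N (datumOfRecord₁₃SepCoPR F N θ h) w)
    (hθ : θ.Admissible F N) (hκ : 0 ≤ θ.s2.lf.κ) (hE₀ : 0 ≤ θ.s2.lf.E₀) (hB₀ : 0 ≤ θ.s2.lf.B₀)
    (hsel : θ.ppSel = ppSelLiveOfRecord F N θ.ν θ.τ9 (EOfRecord₁₃ F N θ.toStage13Params) (wOfRecord₉ F N θ.toStage9Params))
    (hT : ∀ P : B12.RunParams, (leavesP w P).b7 → (leavesP w P).b8 → (leavesP w P).b9 → (leavesP w P).b10 → (leavesP w P).b11 →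
      (leavesP w P).smallCouplings → (leavesP w P).smallFieldInductive → (leavesP w P).flowControl →
        ∀ k, k < P.K → SLaw₁₃CoPR F N θ P k → TLaw₁₃CoPR F N θ P k) (P : B12.RunParams) :
    Dag.B14_main (leavesP w P) :=
  b14_main_at_record₁₃SepCoPR_of_liveSel F N θ P w h (construction_eq_of_isRecordOfRecord₁₃CSepCoPR hrec) hθ hκ hE₀ hB₀ hsel (hT P)

/-- **★ THE (B)-FACE's FIRST CONJUNCT `B16.Thm1Printed (datumOfRecord₁₃SepCoPR F N θ h).C` AT THE LIVE SELECTOR FROM THE FULL (S1ᵀ) along the windowed runs** (node00-def-T's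
`thm1Printed_datumOfRecord₁₃SepCoPR_of_tLaw_rOpLeaf` with the leaf SUPPLIED). [cite: Balaban1989LargeFieldII, Thm 1 p.355; Balaban1988Convergent, Thm 1 p.262; Theorem p.245; p.244] -/
theorem thm1Printed_datumOfRecord₁₃SepCoPR_of_laws_of_liveSel (hθ : θ.Admissible F N) (hκ : 0 ≤ θ.s2.lf.κ) (hE₀ : 0 ≤ θ.s2.lf.E₀) (hB₀ : 0 ≤ θ.s2.lf.B₀)
    {γ : ℝ} (hγ : 0 < γ) (hsel : θ.ppSel = ppSelLiveOfRecord F N θ.ν θ.τ9 (EOfRecord₁₃ F N θ.toStage13Params) (wOfRecord₉ F N θ.toStage9Params))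
    (hT : ∀ P : B12.RunParams, ((datumOfRecord₁₃SepCoPR F N θ h).C P).flow.InInterval γ P.K →
      ∀ k, k < P.K → SLaw₁₃CoPR F N θ P k → TLaw₁₃CoPR F N θ P k) :
    B16.Thm1Printed (datumOfRecord₁₃SepCoPR F N θ h).C :=
  thm1Printed_datumOfRecord₁₃SepCoPR_of_tLaw_rOpLeaf F N θ h hγ hT (fun P _ => rOpLeaf_VOfRecord₁₃CoPR_of_liveSel_sepCoPR F N θ P h hθ hκ hE₀ hB₀ hsel)

/-- **`B16.InductionStep` AT THE v1.5 STAGE-13 DATUM AT THE LIVE SELECTOR FROM (S1ᵀ) AT THE `LiveSeq` SEQUENCES ONLY** (K0a's currency; faces `sect2Form_stage13SepCoPR_iff`).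
[cite: Balaban1989LargeFieldII, Thm 1 p.355 and pp.390–391; Balaban1988Convergent, Thm 1 p.262; Theorem p.245; p.244] -/
theorem inductionStep_datumOfRecord₁₃SepCoPR_of_tLawLiveSeq_of_liveSel (hθ : θ.Admissible F N) (hκ : 0 ≤ θ.s2.lf.κ) (hE₀ : 0 ≤ θ.s2.lf.E₀)
    (hB₀ : 0 ≤ θ.s2.lf.B₀) (γ : ℝ) (hsel : θ.ppSel = ppSelLiveOfRecord F N θ.ν θ.τ9 (EOfRecord₁₃ F N θ.toStage13Params) (wOfRecord₉ F N θ.toStage9Params))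
    (hT : ∀ P : B12.RunParams, ((datumOfRecord₁₃SepCoPR F N θ h).C P).flow.InInterval γ P.K → ∀ k, k < P.K → SLaw₁₃CoPR F N θ P k →
      ∃ (t : SeqOfRecord F θ.ν θ.τ9.M (gOfRecord₁₃ F N θ.toStage13Params P) P.K (k + 1) → Sect2.TermValues (F.P P.K) (MatA N) (FluctV N) θ.τ9.M)
      (Ek : SeqOfRecord F θ.ν θ.τ9.M (gOfRecord₁₃ F N θ.toStage13Params P) P.K (k + 1) → ℝ), Sect2.UniversalE t ∧
      ∀ s, Sect2.LawsT (sect2TowerOfRecord F N (FluctV N) P.K (settingOfRecord₁₃ F N θ.toStage13Params P) (θ.Rz P.K) s (t s)) (settingOfRecord₁₃ F N θ.toStage13Params P).lf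
          (settingOfRecord₁₃ F N θ.toStage13Params P).βc k ∧
        (LiveSeq F N θ.ν θ.τ9 P (gOfRecord₁₃ F N θ.toStage13Params P) (k + 1)
            (slotsTOfRecord F N θ.ν θ.τ9 (EOfRecord₁₃ F N θ.toStage13Params) (wOfRecord₉ F N θ.toStage9Params) θ.ppSel P (gOfRecord₁₃ F N θ.toStage13Params P) (k + 1)) s →
          (slotsTOfRecord F N θ.ν θ.τ9 (EOfRecord₁₃ F N θ.toStage13Params) (wOfRecord₉ F N θ.toStage9Params) θ.ppSel P (gOfRecord₁₃ F N θ.toStage13Params P) (k + 1) s = 0 ∨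
            ∀ᵐ V ∂(fieldMeasure (F.P P.K) (k + 1) (SU N)), chiSeqOfRecord F N θ.ν θ.τ9.M (gOfRecord₁₃ F N θ.toStage13Params P) P.K (k + 1) s V ≠ 0 →
              slotsTOfRecord F N θ.ν θ.τ9 (EOfRecord₁₃ F N θ.toStage13Params) (wOfRecord₉ F N θ.toStage9Params) θ.ppSel P (gOfRecord₁₃ F N θ.toStage13Params P) (k + 1) s V
                = sect2Slot F N (FluctV N) P.K (settingOfRecord₁₃ F N θ.toStage13Params P) (θ.Rz P.K) (WtOfRecord₁₃R F N θ P) s (t s) (Ek s)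
                    (UbgOfRecord₁₃CoP F N θ.toStage13Params P (k + 1) s) V))) :
    B16.InductionStep (datumOfRecord₁₃SepCoPR F N θ h).C γ := by
  intro P hP k hk hS
  have hS' : SLaw₁₃CoPR F N θ P k := (sLaw₁₃CoPR_iff F N θ P k).mpr ((sect2Form_stage13SepCoPR_iff F N θ h P k).mp hS)
  exact (sect2Form_stage13SepCoPR_iff F N θ h P (k + 1)).mpr
    (hasSect2FormAEZ_succ_of_liveSeqTAEZ_of_liveSel_of_rstep F N θ.toStage13Params P (rstep_of_provisos₁₃SepCoPR h) hθ hκ hE₀ hB₀ hsel k hk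
      (WtOfRecord₁₃R F N θ P) (UbgOfRecord₁₃CoP F N θ.toStage13Params P (k + 1)) (hT P hP k hk hS'))

/-- **★ THE (B)-FACE's FIRST CONJUNCT AT THE v1.5 DATUM AT THE LIVE SELECTOR FROM (S1ᵀ) AT THE `LiveSeq` SEQUENCES ONLY** (`0 < γ`; base `inductionBase_datumOfRecord₁₃SepCoPR`).
[cite: Balaban1989LargeFieldII, Thm 1 p.355 + p.391; Balaban1988Convergent, Thm 1 p.262; Theorem p.245] -/
theorem thm1Printed_datumOfRecord₁₃SepCoPR_of_lawsLive_of_liveSel (hθ : θ.Admissible F N) (hκ : 0 ≤ θ.s2.lf.κ) (hE₀ : 0 ≤ θ.s2.lf.E₀)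
    (hB₀ : 0 ≤ θ.s2.lf.B₀) {γ : ℝ} (hγ : 0 < γ) (hsel : θ.ppSel = ppSelLiveOfRecord F N θ.ν θ.τ9 (EOfRecord₁₃ F N θ.toStage13Params) (wOfRecord₉ F N θ.toStage9Params))
    (hT : ∀ P : B12.RunParams, ((datumOfRecord₁₃SepCoPR F N θ h).C P).flow.InInterval γ P.K → ∀ k, k < P.K → SLaw₁₃CoPR F N θ P k →
      ∃ (t : SeqOfRecord F θ.ν θ.τ9.M (gOfRecord₁₃ F N θ.toStage13Params P) P.K (k + 1) → Sect2.TermValues (F.P P.K) (MatA N) (FluctV N) θ.τ9.M)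
      (Ek : SeqOfRecord F θ.ν θ.τ9.M (gOfRecord₁₃ F N θ.toStage13Params P) P.K (k + 1) → ℝ), Sect2.UniversalE t ∧
      ∀ s, Sect2.LawsT (sect2TowerOfRecord F N (FluctV N) P.K (settingOfRecord₁₃ F N θ.toStage13Params P) (θ.Rz P.K) s (t s)) (settingOfRecord₁₃ F N θ.toStage13Params P).lf
          (settingOfRecord₁₃ F N θ.toStage13Params P).βc k ∧
        (LiveSeq F N θ.ν θ.τ9 P (gOfRecord₁₃ F N θ.toStage13Params P) (k + 1)
            (slotsTOfRecord F N θ.ν θ.τ9 (EOfRecord₁₃ F N θ.toStage13Params) (wOfRecord₉ F N θ.toStage9Params) θ.ppSel P (gOfRecord₁₃ F N θ.toStage13Params P) (k + 1)) s →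
          (slotsTOfRecord F N θ.ν θ.τ9 (EOfRecord₁₃ F N θ.toStage13Params) (wOfRecord₉ F N θ.toStage9Params) θ.ppSel P (gOfRecord₁₃ F N θ.toStage13Params P) (k + 1) s = 0 ∨
            ∀ᵐ V ∂(fieldMeasure (F.P P.K) (k + 1) (SU N)), chiSeqOfRecord F N θ.ν θ.τ9.M (gOfRecord₁₃ F N θ.toStage13Params P) P.K (k + 1) s V ≠ 0 →
              slotsTOfRecord F N θ.ν θ.τ9 (EOfRecord₁₃ F N θ.toStage13Params) (wOfRecord₉ F N θ.toStage9Params) θ.ppSel P (gOfRecord₁₃ F N θ.toStage13Params P) (k + 1) s V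
                = sect2Slot F N (FluctV N) P.K (settingOfRecord₁₃ F N θ.toStage13Params P) (θ.Rz P.K) (WtOfRecord₁₃R F N θ P) s (t s) (Ek s)
                    (UbgOfRecord₁₃CoP F N θ.toStage13Params P (k + 1) s) V))) :
    B16.Thm1Printed (datumOfRecord₁₃SepCoPR F N θ h).C :=
  B16.thm1_of_steps _ γ hγ (inductionBase_datumOfRecord₁₃SepCoPR F N θ h γ)
    (inductionStep_datumOfRecord₁₃SepCoPR_of_tLawLiveSeq_of_liveSel F N θ h hθ hκ hE₀ hB₀ γ hsel hT)

end Junction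

/-! ## §3  AT K0a's LIVE RE-PIN `θ.liveRepin₁₃` (the selector clause is `rfl`) with the v1.5 datum -/

section Repin

variable (θ : Stage13Params F N) (Zr : (q : B12.RunParams) → TkResidualW F N (FluctV N) q.K) (p : B12.RunParams) (w : WorldP)

/-- **The (R₁₃) slot in law form at the re-pin from `Provisos₁₃SepCoPR` there.** [cite: Balaban1988Convergent, p.244 (bookkeeping); Balaban1989LargeFieldII, Thm 1 p.355 (not exercised)] -/
theorem laws₁₃CoPR_liveRepin₁₃_sepCoPR (h : (⟨θ.liveRepin₁₃ F N, Zr⟩ : Stage13RParams F N).Provisos₁₃SepCoPR F N) (hθ : θ.Admissible F N) (hκ : 0 ≤ θ.s2.lf.κ) (hE₀ : 0 ≤ θ.s2.lf.E₀)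
    (hB₀ : 0 ≤ θ.s2.lf.B₀) :
    ∀ k, k < p.K → TLaw₁₃CoPR F N (⟨θ.liveRepin₁₃ F N, Zr⟩ : Stage13RParams F N) p k → SLaw₁₃CoPR F N (⟨θ.liveRepin₁₃ F N, Zr⟩ : Stage13RParams F N) p (k + 1) :=
  laws₁₃CoPR_of_liveSel_sepCoPR F N (⟨θ.liveRepin₁₃ F N, Zr⟩ : Stage13RParams F N) p h hθ.liveRepin₁₃ hκ hE₀ hB₀ (liveRepin₁₃_liveSel F N θ)

variable (h : (⟨θ.liveRepin₁₃ F N, Zr⟩ : Stage13RParams F N).Provisos₁₃SepCoPR F N)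

/-- **N11 · `Dag.B14_main` AT A WORLD BOUND TO THE RE-PIN's v1.5 DATUM — ONE DISPLAYED SLOT (S1ᵀ).** [cite: Balaban1988Convergent, Thm 1 p.262; Theorem p.245; p.244; (2.6) p.255] -/
theorem b14_main_at_record₁₃SepCoPR_liveRepin₁₃ (hC : w.C = (datumOfRecord₁₃SepCoPR F N (⟨θ.liveRepin₁₃ F N, Zr⟩ : Stage13RParams F N) h).C) (hθ : θ.Admissible F N) (hκ : 0 ≤ θ.s2.lf.κ)
    (hE₀ : 0 ≤ θ.s2.lf.E₀) (hB₀ : 0 ≤ θ.s2.lf.B₀)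
    (hT : (leavesP w p).b7 → (leavesP w p).b8 → (leavesP w p).b9 → (leavesP w p).b10 → (leavesP w p).b11 →
      (leavesP w p).smallCouplings → (leavesP w p).smallFieldInductive → (leavesP w p).flowControl →
        ∀ k, k < p.K → SLaw₁₃CoPR F N (⟨θ.liveRepin₁₃ F N, Zr⟩ : Stage13RParams F N) p k → TLaw₁₃CoPR F N (⟨θ.liveRepin₁₃ F N, Zr⟩ : Stage13RParams F N) p k) :
    Dag.B14_main (leavesP w p) :=
  b14_main_at_record₁₃SepCoPR_of_liveSel F N (⟨θ.liveRepin₁₃ F N, Zr⟩ : Stage13RParams F N) p w h hC hθ.liveRepin₁₃ hκ hE₀ hB₀ (liveRepin₁₃_liveSel F N θ) hT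

/-- **★ THE (B)-FACE's FIRST CONJUNCT AT THE RE-PIN's v1.5 DATUM FROM THE FULL (S1ᵀ) along the windowed runs.** [cite: Balaban1989LargeFieldII, Thm 1 p.355; Balaban1988Convergent, Thm 1 p.262; Theorem p.245; p.244] -/
theorem thm1Printed_datumOfRecord₁₃SepCoPR_liveRepin₁₃_of_laws (hθ : θ.Admissible F N) (hκ : 0 ≤ θ.s2.lf.κ) (hE₀ : 0 ≤ θ.s2.lf.E₀) (hB₀ : 0 ≤ θ.s2.lf.B₀)
    {γ : ℝ} (hγ : 0 < γ)
    (hT : ∀ P : B12.RunParams, ((datumOfRecord₁₃SepCoPR F N (⟨θ.liveRepin₁₃ F N, Zr⟩ : Stage13RParams F N) h).C P).flow.InInterval γ P.K →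
      ∀ k, k < P.K → SLaw₁₃CoPR F N (⟨θ.liveRepin₁₃ F N, Zr⟩ : Stage13RParams F N) P k → TLaw₁₃CoPR F N (⟨θ.liveRepin₁₃ F N, Zr⟩ : Stage13RParams F N) P k) :
    B16.Thm1Printed (datumOfRecord₁₃SepCoPR F N (⟨θ.liveRepin₁₃ F N, Zr⟩ : Stage13RParams F N) h).C :=
  thm1Printed_datumOfRecord₁₃SepCoPR_of_laws_of_liveSel F N (⟨θ.liveRepin₁₃ F N, Zr⟩ : Stage13RParams F N) h hθ.liveRepin₁₃ hκ hE₀ hB₀ hγ (liveRepin₁₃_liveSel F N θ) hT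

end Repin

/-! ## §4  AT THE WITNESSES CARRYING K0b's RESIDUALS with the v1.5 datum binder (admissibility and signs by the numerals of record) -/

section OfRecord

variable (Zr : (q : B12.RunParams) → TkResidualW F N (FluctV N) q.K) (p : B12.RunParams) (w : WorldP) (h : (⟨theta13LiveOfRecord F N, Zr⟩ : Stage13RParams F N).Provisos₁₃SepCoPR F N)

/-- **N11 · `Dag.B14_main` AT A WORLD BOUND TO THE v1.5 DATUM OF THE WITNESS OF RECORD — ONE DISPLAYED SLOT (S1ᵀ), nothing else** (the 𝐑-slot is the closed theorem
`rOpLeaf_VOfRecord₁₃CoPR_theta13LiveOfRecord`). [cite: Balaban1988Convergent, Thm 1 p.262; Theorem p.245; p.244; (2.6) p.255] -/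
theorem b14_main_at_record₁₃SepCoPR_theta13LiveOfRecord (hC : w.C = (datumOfRecord₁₃SepCoPR F N (⟨theta13LiveOfRecord F N, Zr⟩ : Stage13RParams F N) h).C)
    (hT : (leavesP w p).b7 → (leavesP w p).b8 → (leavesP w p).b9 → (leavesP w p).b10 → (leavesP w p).b11 →
      (leavesP w p).smallCouplings → (leavesP w p).smallFieldInductive → (leavesP w p).flowControl →
        ∀ k, k < p.K → SLaw₁₃CoPR F N (⟨theta13LiveOfRecord F N, Zr⟩ : Stage13RParams F N) p k → TLaw₁₃CoPR F N (⟨theta13LiveOfRecord F N, Zr⟩ : Stage13RParams F N) p k) :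
    Dag.B14_main (leavesP w p) :=
  b14_main_at_record₁₃SepCoPR_of_rOpLeaf F N (⟨theta13LiveOfRecord F N, Zr⟩ : Stage13RParams F N) p w h hC (fun _ => rOpLeaf_VOfRecord₁₃CoPR_theta13LiveOfRecord F N Zr p) hT

/-- **★ THE (B)-FACE's FIRST CONJUNCT AT THE v1.5 DATUM OF THE WITNESS OF RECORD FROM THE FULL (S1ᵀ) along the windowed runs** (`0 < γ`; the 𝐑-slot closed).
[cite: Balaban1989LargeFieldII, Thm 1 p.355; Balaban1988Convergent, Thm 1 p.262; Theorem p.245; p.244] -/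
theorem thm1Printed_datumOfRecord₁₃SepCoPR_theta13LiveOfRecord_of_laws {γ : ℝ} (hγ : 0 < γ)
    (hT : ∀ P : B12.RunParams, ((datumOfRecord₁₃SepCoPR F N (⟨theta13LiveOfRecord F N, Zr⟩ : Stage13RParams F N) h).C P).flow.InInterval γ P.K →
      ∀ k, k < P.K → SLaw₁₃CoPR F N (⟨theta13LiveOfRecord F N, Zr⟩ : Stage13RParams F N) P k → TLaw₁₃CoPR F N (⟨theta13LiveOfRecord F N, Zr⟩ : Stage13RParams F N) P k) :
    B16.Thm1Printed (datumOfRecord₁₃SepCoPR F N (⟨theta13LiveOfRecord F N, Zr⟩ : Stage13RParams F N) h).C :=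
  thm1Printed_datumOfRecord₁₃SepCoPR_of_tLaw_rOpLeaf F N (⟨theta13LiveOfRecord F N, Zr⟩ : Stage13RParams F N) h hγ hT (fun P _ => rOpLeaf_VOfRecord₁₃CoPR_theta13LiveOfRecord F N Zr P)

/-- **`densitiesDescribed` AT A WORLD BOUND TO THE v1.5 DATUM OF THE WITNESS OF RECORD FROM (S1ᵀ) ALONE.** [cite: Balaban1988Convergent, Thm 1 p.262; Theorem p.245; p.244] -/
theorem densitiesDescribed_at_record₁₃SepCoPR_theta13LiveOfRecord (hC : w.C = (datumOfRecord₁₃SepCoPR F N (⟨theta13LiveOfRecord F N, Zr⟩ : Stage13RParams F N) h).C)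
    (hT : ∀ k, k < p.K → SLaw₁₃CoPR F N (⟨theta13LiveOfRecord F N, Zr⟩ : Stage13RParams F N) p k → TLaw₁₃CoPR F N (⟨theta13LiveOfRecord F N, Zr⟩ : Stage13RParams F N) p k) :
    (leavesP w p).densitiesDescribed :=
  densitiesDescribed_at_record₁₃SepCoPR_of_laws F N (⟨theta13LiveOfRecord F N, Zr⟩ : Stage13RParams F N) p w h hC (laws₁₃CoPR_theta13LiveOfRecord F N Zr p) hT

end OfRecord

section Thm1CC1Witness

variable (Zr : (q : B12.RunParams) → TkResidualW F N (FluctV N) q.K) {ε₀ ε₂₉ B₃ B₃' a₀ a₁ : ℝ} (p : B12.RunParams) (w : WorldP) (h : (⟨theta13OfThm1CC1 F N ε₀ ε₂₉ B₃ B₃' a₀ a₁, Zr⟩ : Stage13RParams F N).Provisos₁₃SepCoPR F N)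

/-- **N11 · `Dag.B14_main` AT A WORLD BOUND TO THE v1.5 DATUM OF K0a's C¹-ROUTE WITNESS `θ₁₅ᶜᶜ¹` — (S1ᵀ) + the six admissibility signs** (the CoP leaf is
`…LiveCoP.rOpLeaf_VOfRecord₁₃CoPR_theta13OfThm1CC1`). [cite: Balaban1988Convergent, Thm 1 p.262; Theorem p.245; p.244; (2.6) p.255; Balaban1985Variational, Thm 1 p.279 (witness letters only)] -/
theorem b14_main_at_record₁₃SepCoPR_theta13OfThm1CC1 (hε : 0 < ε₀) (hε' : 0 < ε₂₉) (hB : 0 ≤ B₃) (hB' : 0 ≤ B₃') (ha₀ : 0 < a₀) (ha₁ : 0 < a₁)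
    (hC : w.C = (datumOfRecord₁₃SepCoPR F N (⟨theta13OfThm1CC1 F N ε₀ ε₂₉ B₃ B₃' a₀ a₁, Zr⟩ : Stage13RParams F N) h).C)
    (hT : (leavesP w p).b7 → (leavesP w p).b8 → (leavesP w p).b9 → (leavesP w p).b10 → (leavesP w p).b11 →
      (leavesP w p).smallCouplings → (leavesP w p).smallFieldInductive → (leavesP w p).flowControl →
        ∀ k, k < p.K → SLaw₁₃CoPR F N (⟨theta13OfThm1CC1 F N ε₀ ε₂₉ B₃ B₃' a₀ a₁, Zr⟩ : Stage13RParams F N) p k → TLaw₁₃CoPR F N (⟨theta13OfThm1CC1 F N ε₀ ε₂₉ B₃ B₃' a₀ a₁, Zr⟩ : Stage13RParams F N) p k) :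
    Dag.B14_main (leavesP w p) :=
  b14_main_at_record₁₃SepCoPR_of_rOpLeaf F N _ p w h hC (fun _ => rOpLeaf_VOfRecord₁₃CoPR_theta13OfThm1CC1 F N Zr p hε hε' hB hB' ha₀ ha₁) hT

/-- **★ THE (B)-FACE's FIRST CONJUNCT AT THE v1.5 DATUM OF `θ₁₅ᶜᶜ¹` FROM THE FULL (S1ᵀ)** (`0 < γ`; six signs). [cite: Balaban1989LargeFieldII, Thm 1 p.355; Balaban1988Convergent, Thm 1 p.262; Theorem p.245; p.244] -/
theorem thm1Printed_datumOfRecord₁₃SepCoPR_theta13OfThm1CC1_of_laws (hε : 0 < ε₀) (hε' : 0 < ε₂₉) (hB : 0 ≤ B₃) (hB' : 0 ≤ B₃') (ha₀ : 0 < a₀) (ha₁ : 0 < a₁)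
    {γ : ℝ} (hγ : 0 < γ)
    (hT : ∀ P : B12.RunParams, ((datumOfRecord₁₃SepCoPR F N (⟨theta13OfThm1CC1 F N ε₀ ε₂₉ B₃ B₃' a₀ a₁, Zr⟩ : Stage13RParams F N) h).C P).flow.InInterval γ P.K →
      ∀ k, k < P.K → SLaw₁₃CoPR F N (⟨theta13OfThm1CC1 F N ε₀ ε₂₉ B₃ B₃' a₀ a₁, Zr⟩ : Stage13RParams F N) P k → TLaw₁₃CoPR F N (⟨theta13OfThm1CC1 F N ε₀ ε₂₉ B₃ B₃' a₀ a₁, Zr⟩ : Stage13RParams F N) P k) :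
    B16.Thm1Printed (datumOfRecord₁₃SepCoPR F N (⟨theta13OfThm1CC1 F N ε₀ ε₂₉ B₃ B₃' a₀ a₁, Zr⟩ : Stage13RParams F N) h).C :=
  thm1Printed_datumOfRecord₁₃SepCoPR_of_tLaw_rOpLeaf F N _ h hγ hT (fun P _ => rOpLeaf_VOfRecord₁₃CoPR_theta13OfThm1CC1 F N Zr P hε hε' hB hB' ha₀ ha₁)

end Thm1CC1Witness

section Numerics

variable (Zr : (q : B12.RunParams) → TkResidualW F N (FluctV N) q.K) {n : Stage12Numerics} {ε₂₉ : ℝ} (p : B12.RunParams) (w : WorldP)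
  (h : (⟨theta13LiveOfNumerics F N n ε₂₉ (zeta316OfRecord F N n.ν n.τ9.M n.A₁) (RzOfRecord F N) (ZtOfRecord F N), Zr⟩ : Stage13RParams F N).Provisos₁₃SepCoPR F N)

/-- **N11 · `Dag.B14_main` AT A WORLD BOUND TO THE v1.5 DATUM OF THE ALL-NUMERICS WITNESS `θ₁₃(n, ε₂₉)`** (`n.Pos`, `0 < ε₂₉`, the three signs of `n`; (S1ᵀ)).
[cite: Balaban1988Convergent, Thm 1 p.262; Theorem p.245; p.244; (2.6) p.255] -/
theorem b14_main_at_record₁₃SepCoPR_theta13LiveOfNumerics (hn : n.Pos) (hε' : 0 < ε₂₉) (hκ : 0 ≤ n.s2.lf.κ) (hE₀ : 0 ≤ n.s2.lf.E₀) (hB₀ : 0 ≤ n.s2.lf.B₀)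
    (hC : w.C = (datumOfRecord₁₃SepCoPR F N (⟨theta13LiveOfNumerics F N n ε₂₉ (zeta316OfRecord F N n.ν n.τ9.M n.A₁) (RzOfRecord F N) (ZtOfRecord F N), Zr⟩ : Stage13RParams F N) h).C)
    (hT : (leavesP w p).b7 → (leavesP w p).b8 → (leavesP w p).b9 → (leavesP w p).b10 → (leavesP w p).b11 →
      (leavesP w p).smallCouplings → (leavesP w p).smallFieldInductive → (leavesP w p).flowControl →
        ∀ k, k < p.K → SLaw₁₃CoPR F N (⟨theta13LiveOfNumerics F N n ε₂₉ (zeta316OfRecord F N n.ν n.τ9.M n.A₁) (RzOfRecord F N) (ZtOfRecord F N), Zr⟩ : Stage13RParams F N) p k →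
          TLaw₁₃CoPR F N (⟨theta13LiveOfNumerics F N n ε₂₉ (zeta316OfRecord F N n.ν n.τ9.M n.A₁) (RzOfRecord F N) (ZtOfRecord F N), Zr⟩ : Stage13RParams F N) p k) :
    Dag.B14_main (leavesP w p) :=
  b14_main_at_record₁₃SepCoPR_of_rOpLeaf F N _ p w h hC (fun _ => rOpLeaf_VOfRecord₁₃CoPR_theta13LiveOfNumerics F N Zr p hn hε' hκ hE₀ hB₀) hT

/-- **★ THE (B)-FACE's FIRST CONJUNCT AT THE v1.5 DATUM OF `θ₁₃(n, ε₂₉)` FROM THE FULL (S1ᵀ)** (`0 < γ`; `n.Pos`, `0 < ε₂₉`, signs).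
[cite: Balaban1989LargeFieldII, Thm 1 p.355; Balaban1988Convergent, Thm 1 p.262; Theorem p.245; p.244] -/
theorem thm1Printed_datumOfRecord₁₃SepCoPR_theta13LiveOfNumerics_of_laws (hn : n.Pos) (hε' : 0 < ε₂₉) (hκ : 0 ≤ n.s2.lf.κ) (hE₀ : 0 ≤ n.s2.lf.E₀)
    (hB₀ : 0 ≤ n.s2.lf.B₀) {γ : ℝ} (hγ : 0 < γ)
    (hT : ∀ P : B12.RunParams, ((datumOfRecord₁₃SepCoPR F N (⟨theta13LiveOfNumerics F N n ε₂₉ (zeta316OfRecord F N n.ν n.τ9.M n.A₁) (RzOfRecord F N) (ZtOfRecord F N), Zr⟩ : Stage13RParams F N) h).C P).flow.InInterval γ P.K →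
      ∀ k, k < P.K → SLaw₁₃CoPR F N (⟨theta13LiveOfNumerics F N n ε₂₉ (zeta316OfRecord F N n.ν n.τ9.M n.A₁) (RzOfRecord F N) (ZtOfRecord F N), Zr⟩ : Stage13RParams F N) P k →
        TLaw₁₃CoPR F N (⟨theta13LiveOfNumerics F N n ε₂₉ (zeta316OfRecord F N n.ν n.τ9.M n.A₁) (RzOfRecord F N) (ZtOfRecord F N), Zr⟩ : Stage13RParams F N) P k) :
    B16.Thm1Printed (datumOfRecord₁₃SepCoPR F N (⟨theta13LiveOfNumerics F N n ε₂₉ (zeta316OfRecord F N n.ν n.τ9.M n.A₁) (RzOfRecord F N) (ZtOfRecord F N), Zr⟩ : Stage13RParams F N) h).C :=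
  thm1Printed_datumOfRecord₁₃SepCoPR_of_tLaw_rOpLeaf F N _ h hγ hT (fun P _ => rOpLeaf_VOfRecord₁₃CoPR_theta13LiveOfNumerics F N Zr P hn hε' hκ hE₀ hB₀)

end Numerics

/-! ## §6  KEYED on the v1.5 (D, w)-interface `IsRecordOfRecord₁₃CSepCoPR`: Theorem 1's conclusion at every run, relative to the world's OWN 𝐑-leaves -/

section KeyedSep

variable {F N}
variable {D : FiniteEpsData F (SU N)} {w : WorldP}

/-- **THEOREM 1's CONCLUSION AT EVERY RUN OF A v1.5 STAGE-13 RECORD, RELATIVE TO 𝐑 AND THE THEOREM OF p. 245** (the (D, w)-face): the record PRESENTS `θ` with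
`Provisos₁₃SepCoPR` and `D = datumOfRecord₁₃SepCoPR θ hP`; at every run the world's own `rOperation` antecedent (N13's product; the leaf by the C-binding) and the Theorem of
p. 245 at the presenting objects give `(leavesP w P).densitiesDescribed`. [cite: Balaban1988Convergent, Thm 1 p.262; Theorem p.245; p.244; Balaban1989LargeFieldII, Thm 1 p.355 (bookkeeping)] -/
theorem densitiesDescribed_of_isRecordOfRecord₁₃CSepCoPR_of_rOperation (hrec : IsRecordOfRecord₁₃CSepCoPR F N D w) :
    ∃ (θ : Stage13RParams F N) (hP : θ.Provisos₁₃SepCoPR F N), θ.Admissible F N ∧ D = datumOfRecord₁₃SepCoPR F N θ hP ∧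
      ∀ P : B12.RunParams, (leavesP w P).rOperation → (∀ k, k < P.K → SLaw₁₃CoPR F N θ P k → TLaw₁₃CoPR F N θ P k) →
        (leavesP w P).densitiesDescribed := by
  obtain ⟨θ, hP, hθ, hD, hC, -, -, hup⟩ := hrec
  refine ⟨θ, hP, hθ, hD, fun P hrop hT => ?_⟩
  have hR : ∀ k, k < P.K → TLaw₁₃CoPR F N θ P k → SLaw₁₃CoPR F N θ P (k + 1) := by
    have h1 : (w.up P).rOperation := hrop
    rw [hup P, rOperation_upOfRecord₅C_stage13CoPR_iff] at h1
    exact h1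
  exact densitiesDescribed_at_record₁₃SepCoPR_of_laws F N θ P w hP (by rw [hC, hD]) hR hT

end KeyedSep

/-! ## §8  N11's PER-LEVEL SHARE ON PRINT'S RANGE: the §2 dichotomy of `𝐓ρ_k`'s slots is needed only at sequences that are LIVE **and** `Sect2.SeqSeparated`
(a live sequence has a non-zero 𝐓-slot, hence is separated — `…B14SeparationOfRecord`), under `0 < M₁ ≤ M` (K0a's witnesses: `M₁ = M = 1`) -/

section PrintRange

variable (θ : Stage13RParams F N) (p : B12.RunParams)

/-- **★ AT THE LIVE SELECTOR: `TLaw` AT THE LIVE ∧ SEPARATED SEQUENCES ONLY ⇒ `SLaw₁₃CoPR (k+1)`** (`0 < M₁ ≤ M`; from `Provisos₁₃SepCoPR`'s row `rstep`): N11's per-level share of Theorem 1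
on the witness line, stated ON PRINT'S RANGE — the §2 dichotomy of `𝐓ρ_k`'s slots is demanded only at sequences that carry fibre mass AND are admissible in the sense of
[6] (1.3)–(1.6); the 𝐓-image laws at every sequence. [cite: Balaban1988Convergent, §2 p.262, Thm 2 p.263, (3.24)–(3.25) p.270, p.256; Balaban1989LargeFieldI, (0.3) p.176, p.177 (i)–(ii); Balaban1985RegularSpaces, (1.3)–(1.6) p.77] -/
theorem sLaw₁₃CoPR_succ_of_tLawLiveSep_of_liveSel_sepCoPR (h : θ.Provisos₁₃SepCoPR F N) (hθ : θ.Admissible F N) (hκ : 0 ≤ θ.s2.lf.κ) (hE₀ : 0 ≤ θ.s2.lf.E₀)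
    (hB₀ : 0 ≤ θ.s2.lf.B₀) (hM₁ : 0 < θ.ν.M₁) (hle : θ.ν.M₁ ≤ θ.τ9.M)
    (hsel : θ.ppSel = ppSelLiveOfRecord F N θ.ν θ.τ9 (EOfRecord₁₃ F N θ.toStage13Params) (wOfRecord₉ F N θ.toStage9Params)) (k : ℕ) (hk : k < p.K)
    (hT : ∃ (t : SeqOfRecord F θ.ν θ.τ9.M (gOfRecord₁₃ F N θ.toStage13Params p) p.K (k + 1) → Sect2.TermValues (F.P p.K) (MatA N) (FluctV N) θ.τ9.M)
      (Ek : SeqOfRecord F θ.ν θ.τ9.M (gOfRecord₁₃ F N θ.toStage13Params p) p.K (k + 1) → ℝ), Sect2.UniversalE t ∧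
      ∀ s, Sect2.LawsT (sect2TowerOfRecord F N (FluctV N) p.K (settingOfRecord₁₃ F N θ.toStage13Params p) (θ.Rz p.K) s (t s)) (settingOfRecord₁₃ F N θ.toStage13Params p).lf
          (settingOfRecord₁₃ F N θ.toStage13Params p).βc k ∧
        (LiveSeq F N θ.ν θ.τ9 p (gOfRecord₁₃ F N θ.toStage13Params p) (k + 1)
            (slotsTOfRecord F N θ.ν θ.τ9 (EOfRecord₁₃ F N θ.toStage13Params) (wOfRecord₉ F N θ.toStage9Params) θ.ppSel p (gOfRecord₁₃ F N θ.toStage13Params p) (k + 1)) s →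
          Sect2.SeqSeparated θ.ν.M₁ s →
          (slotsTOfRecord F N θ.ν θ.τ9 (EOfRecord₁₃ F N θ.toStage13Params) (wOfRecord₉ F N θ.toStage9Params) θ.ppSel p (gOfRecord₁₃ F N θ.toStage13Params p) (k + 1) s = 0 ∨
            ∀ᵐ V ∂(fieldMeasure (F.P p.K) (k + 1) (SU N)), chiSeqOfRecord F N θ.ν θ.τ9.M (gOfRecord₁₃ F N θ.toStage13Params p) p.K (k + 1) s V ≠ 0 →
              slotsTOfRecord F N θ.ν θ.τ9 (EOfRecord₁₃ F N θ.toStage13Params) (wOfRecord₉ F N θ.toStage9Params) θ.ppSel p (gOfRecord₁₃ F N θ.toStage13Params p) (k + 1) s V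
                = sect2Slot F N (FluctV N) p.K (settingOfRecord₁₃ F N θ.toStage13Params p) (θ.Rz p.K) (WtOfRecord₁₃R F N θ p) s (t s) (Ek s)
                    (UbgOfRecord₁₃CoP F N θ.toStage13Params p (k + 1) s) V))) :
    SLaw₁₃CoPR F N θ p (k + 1) := by
  obtain ⟨t, Ek, hu, hs⟩ := hT
  exact (sLaw₁₃CoPR_iff F N θ p (k + 1)).mpr
    (hasSect2FormAEZ_succ_of_liveSeqTAEZ_of_liveSel_of_rstep F N θ.toStage13Params p (rstep_of_provisos₁₃SepCoPR h) hθ hκ hE₀ hB₀ hsel k hk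
      (WtOfRecord₁₃R F N θ p) (UbgOfRecord₁₃CoP F N θ.toStage13Params p (k + 1))
      ⟨t, Ek, hu, fun s => ⟨(hs s).1, fun hl => (hs s).2 hl (B16RLeafRecord13Sep.seqSeparated_of_liveSeq₁₃ F N θ.toStage13Params p hM₁ hle k s hl)⟩⟩)

/-- **★ THEOREM 1 [III] AT THE LIVE SELECTOR FROM (S1ᵀ) ON PRINT'S RANGE** (live ∧ separated sequences only; `0 < M₁ ≤ M`): `∀ k ≤ K, SLaw₁₃CoPR θ p k`.
[cite: Balaban1988Convergent, Thm 1 p.262; Theorem p.245; p.244, p.256; Balaban1989LargeFieldI, (0.3) p.176, p.177 (i)–(ii); Balaban1985RegularSpaces, (1.3)–(1.6) p.77] -/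
theorem sLaw₁₃CoPR_all_of_thmP245LiveSep_of_liveSel_sepCoPR (h : θ.Provisos₁₃SepCoPR F N) (hθ : θ.Admissible F N) (hκ : 0 ≤ θ.s2.lf.κ) (hE₀ : 0 ≤ θ.s2.lf.E₀)
    (hB₀ : 0 ≤ θ.s2.lf.B₀) (hM₁ : 0 < θ.ν.M₁) (hle : θ.ν.M₁ ≤ θ.τ9.M)
    (hsel : θ.ppSel = ppSelLiveOfRecord F N θ.ν θ.τ9 (EOfRecord₁₃ F N θ.toStage13Params) (wOfRecord₉ F N θ.toStage9Params))
    (hT : ∀ k, k < p.K → SLaw₁₃CoPR F N θ p k →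
      ∃ (t : SeqOfRecord F θ.ν θ.τ9.M (gOfRecord₁₃ F N θ.toStage13Params p) p.K (k + 1) → Sect2.TermValues (F.P p.K) (MatA N) (FluctV N) θ.τ9.M)
      (Ek : SeqOfRecord F θ.ν θ.τ9.M (gOfRecord₁₃ F N θ.toStage13Params p) p.K (k + 1) → ℝ), Sect2.UniversalE t ∧
      ∀ s, Sect2.LawsT (sect2TowerOfRecord F N (FluctV N) p.K (settingOfRecord₁₃ F N θ.toStage13Params p) (θ.Rz p.K) s (t s)) (settingOfRecord₁₃ F N θ.toStage13Params p).lf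
          (settingOfRecord₁₃ F N θ.toStage13Params p).βc k ∧
        (LiveSeq F N θ.ν θ.τ9 p (gOfRecord₁₃ F N θ.toStage13Params p) (k + 1)
            (slotsTOfRecord F N θ.ν θ.τ9 (EOfRecord₁₃ F N θ.toStage13Params) (wOfRecord₉ F N θ.toStage9Params) θ.ppSel p (gOfRecord₁₃ F N θ.toStage13Params p) (k + 1)) s →
          Sect2.SeqSeparated θ.ν.M₁ s →
          (slotsTOfRecord F N θ.ν θ.τ9 (EOfRecord₁₃ F N θ.toStage13Params) (wOfRecord₉ F N θ.toStage9Params) θ.ppSel p (gOfRecord₁₃ F N θ.toStage13Params p) (k + 1) s = 0 ∨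
            ∀ᵐ V ∂(fieldMeasure (F.P p.K) (k + 1) (SU N)), chiSeqOfRecord F N θ.ν θ.τ9.M (gOfRecord₁₃ F N θ.toStage13Params p) p.K (k + 1) s V ≠ 0 →
              slotsTOfRecord F N θ.ν θ.τ9 (EOfRecord₁₃ F N θ.toStage13Params) (wOfRecord₉ F N θ.toStage9Params) θ.ppSel p (gOfRecord₁₃ F N θ.toStage13Params p) (k + 1) s V
                = sect2Slot F N (FluctV N) p.K (settingOfRecord₁₃ F N θ.toStage13Params p) (θ.Rz p.K) (WtOfRecord₁₃R F N θ p) s (t s) (Ek s)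
                    (UbgOfRecord₁₃CoP F N θ.toStage13Params p (k + 1) s) V))) :
    ∀ k, k ≤ p.K → SLaw₁₃CoPR F N θ p k := by
  intro k
  induction k with
  | zero => exact fun _ => sLaw₁₃CoPR_zero F N θ p
  | succ n ih =>
    intro hk
    exact sLaw₁₃CoPR_succ_of_tLawLiveSep_of_liveSel_sepCoPR F N θ p h hθ hκ hE₀ hB₀ hM₁ hle hsel n (Nat.lt_of_succ_le hk)
      (hT n (Nat.lt_of_succ_le hk) (ih (Nat.le_of_succ_le hk)))

end PrintRange

/-! ## §7  THE v1.5-KEYED CONVERSE NODE FACES (`densitiesDescribed` ⇒ the `SLaw₁₃CoPR`-side clause at every no-expansion sequence), from `h`'s row `rstep` -/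

section ConverseFaces

variable (θ : Stage13RParams F N) (p : B12.RunParams) (w : WorldP) (h : θ.Provisos₁₃SepCoPR F N)

/-- **N11's conclusion at a world bound to the v1.5 datum IS `∀ k ≤ K, SLaw₁₃CoPR θ p k`** (`…LiveCoP.densitiesDescribed_leavesP_iff_sLaw₁₃CoPR_all` at `datumOfRecord₁₃SepCoPR`'s `C`,
which is the proviso-free CoP construction of record, `Node00.datumOfRecord₁₃SepCoPR_C`). [cite: Balaban1988Convergent, Thm 1 p.262, (2.18) p.257 (bookkeeping at the record)] -/
theorem densitiesDescribed_leavesP_iff_sLaw₁₃CoPR_all_sepCoPR (hC : w.C = (datumOfRecord₁₃SepCoPR F N θ h).C) :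
    (leavesP w p).densitiesDescribed ↔ ∀ k, k ≤ p.K → SLaw₁₃CoPR F N θ p k :=
  densitiesDescribed_leavesP_iff_sLaw₁₃CoPR_all F N θ p w (by rw [hC]; rfl)

/-- **At the live selector, from `h`'s row `rstep` (NO residual hypothesis): `densitiesDescribed` at a v1.5-datum world ⇒ the `SLaw`-side guard-free clause at every no-expansion sequence of every
level `k < K`.** [cite: Balaban1988Convergent, Thm 1 p.262, (3.25) p.270, Theorem p.245, (3.16) p.268; Balaban1989LargeFieldI, (0.3)–(0.4) p.176] -/
theorem sLaw₁₃CoPR_succ_clause_of_Omega_empty_of_densitiesDescribed_of_liveSel_sepCoPR (hC : w.C = (datumOfRecord₁₃SepCoPR F N θ h).C)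
    (hsel : θ.ppSel = ppSelLiveOfRecord F N θ.ν θ.τ9 (EOfRecord₁₃ F N θ.toStage13Params) (wOfRecord₉ F N θ.toStage9Params))
    (hD : (leavesP w p).densitiesDescribed) {k : ℕ} (hk : k < p.K)
    (s : SeqOfRecord F θ.ν θ.τ9.M (gOfRecord₁₃ F N θ.toStage13Params p) p.K (k + 1)) (hΩ : s.Ω (k + 1) = ∅) :
    ∃ (t : SeqOfRecord F θ.ν θ.τ9.M (gOfRecord₁₃ F N θ.toStage13Params p) p.K (k + 1) → Sect2.TermValues (F.P p.K) (MatA N) (FluctV N) θ.τ9.M)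
      (Ek : SeqOfRecord F θ.ν θ.τ9.M (gOfRecord₁₃ F N θ.toStage13Params p) p.K (k + 1) → ℝ),
      Sect2.UniversalE t ∧
      (∀ s', Sect2.LawsRT (sect2TowerOfRecord F N (FluctV N) p.K (settingOfRecord₁₃ F N θ.toStage13Params p) (θ.Rz p.K) s' (t s'))
        (settingOfRecord₁₃ F N θ.toStage13Params p).lf (k + 1)) ∧
      ((slotsTOfRecord F N θ.ν θ.τ9 (EOfRecord₁₃ F N θ.toStage13Params) (wOfRecord₉ F N θ.toStage9Params) θ.ppSel p
          (gOfRecord₁₃ F N θ.toStage13Params p) (k + 1) s =ᵐ[fieldMeasure (F.P p.K) (k + 1) (SU N)] 0) ∨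
        ∀ᵐ V' ∂fieldMeasure (F.P p.K) (k + 1) (SU N),
          slotsTOfRecord F N θ.ν θ.τ9 (EOfRecord₁₃ F N θ.toStage13Params) (wOfRecord₉ F N θ.toStage9Params) θ.ppSel p
              (gOfRecord₁₃ F N θ.toStage13Params p) (k + 1) s V' =
            sect2Slot F N (FluctV N) p.K (settingOfRecord₁₃ F N θ.toStage13Params p) (θ.Rz p.K) (WtOfRecord₁₃R F N θ p) s (t s) (Ek s)
              (UbgOfRecord₁₃CoP F N θ.toStage13Params p (k + 1) s) V') :=
  sLaw₁₃CoPR_succ_clause_of_Omega_empty_of_liveSel_sepCoPR F N θ p h hsel hk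
    ((densitiesDescribed_leavesP_iff_sLaw₁₃CoPR_all_sepCoPR F N θ p w h hC).1 hD (k + 1) hk) s hΩ

end ConverseFaces

section ConverseFacesOfRecord

variable (Zr : (q : B12.RunParams) → TkResidualW F N (FluctV N) q.K) (p : B12.RunParams) (w : WorldP) (h : (⟨theta13LiveOfRecord F N, Zr⟩ : Stage13RParams F N).Provisos₁₃SepCoPR F N)

/-- **★★★ At a world bound to the v1.5 datum OF THE WITNESS OF RECORD: N11's node conclusion ⇒ the `SLaw`-side clause at every no-expansion sequence, `k < K` —
no further hypothesis** (`…LiveCoP.sLaw₁₃CoPR_succ_clause_of_Omega_empty_of_liveSel_of_rstep` at `h`'s row `rstep`; the selector clause is `rfl`). [cite: Balaban1988Convergent, Thm 1 p.262, (3.25) p.270, Theorem p.245, (3.16) p.268, (3.22) p.269; Balaban1989LargeFieldI, (0.3)–(0.4) p.176] -/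
theorem sLaw₁₃CoPR_succ_clause_of_Omega_empty_of_densitiesDescribed_theta13LiveOfRecord_sepCoPR
    (hC : w.C = (datumOfRecord₁₃SepCoPR F N (⟨theta13LiveOfRecord F N, Zr⟩ : Stage13RParams F N) h).C) (hD : (leavesP w p).densitiesDescribed) {k : ℕ} (hk : k < p.K)
    (s : SeqOfRecord F (theta13LiveOfRecord F N).ν (theta13LiveOfRecord F N).τ9.M (gOfRecord₁₃ F N (theta13LiveOfRecord F N) p) p.K (k + 1))
    (hΩ : s.Ω (k + 1) = ∅) :
    ∃ (t : SeqOfRecord F (theta13LiveOfRecord F N).ν (theta13LiveOfRecord F N).τ9.M (gOfRecord₁₃ F N (theta13LiveOfRecord F N) p) p.K (k + 1) →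
        Sect2.TermValues (F.P p.K) (MatA N) (FluctV N) (theta13LiveOfRecord F N).τ9.M)
      (Ek : SeqOfRecord F (theta13LiveOfRecord F N).ν (theta13LiveOfRecord F N).τ9.M (gOfRecord₁₃ F N (theta13LiveOfRecord F N) p) p.K (k + 1) → ℝ),
      Sect2.UniversalE t ∧
      (∀ s', Sect2.LawsRT (sect2TowerOfRecord F N (FluctV N) p.K (settingOfRecord₁₃ F N (theta13LiveOfRecord F N) p) ((theta13LiveOfRecord F N).Rz p.K) s' (t s'))
        (settingOfRecord₁₃ F N (theta13LiveOfRecord F N) p).lf (k + 1)) ∧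
      ((slotsTOfRecord F N (theta13LiveOfRecord F N).ν (theta13LiveOfRecord F N).τ9 (EOfRecord₁₃ F N (theta13LiveOfRecord F N))
          (wOfRecord₉ F N (theta13LiveOfRecord F N).toStage9Params) (theta13LiveOfRecord F N).ppSel p
          (gOfRecord₁₃ F N (theta13LiveOfRecord F N) p) (k + 1) s =ᵐ[fieldMeasure (F.P p.K) (k + 1) (SU N)] 0) ∨
        ∀ᵐ V' ∂fieldMeasure (F.P p.K) (k + 1) (SU N),
          slotsTOfRecord F N (theta13LiveOfRecord F N).ν (theta13LiveOfRecord F N).τ9 (EOfRecord₁₃ F N (theta13LiveOfRecord F N))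
              (wOfRecord₉ F N (theta13LiveOfRecord F N).toStage9Params) (theta13LiveOfRecord F N).ppSel p
              (gOfRecord₁₃ F N (theta13LiveOfRecord F N) p) (k + 1) s V' =
            sect2Slot F N (FluctV N) p.K (settingOfRecord₁₃ F N (theta13LiveOfRecord F N) p) ((theta13LiveOfRecord F N).Rz p.K)
              (WtOfRecord₁₃R F N (⟨theta13LiveOfRecord F N, Zr⟩ : Stage13RParams F N) p) s (t s) (Ek s)
              (UbgOfRecord₁₃CoP F N (theta13LiveOfRecord F N) p (k + 1) s) V') :=
  sLaw₁₃CoPR_succ_clause_of_Omega_empty_of_liveSel_of_rstep F N (⟨theta13LiveOfRecord F N, Zr⟩ : Stage13RParams F N) p (rstep_of_provisos₁₃SepCoPR h)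
    (liveRepin₁₃_liveSel F N
      (theta13OfFamily F N eps0OfRecord₁₃ (zeta316OfRecord F N (numerics7OfFamily eps0OfRecord₁₃) 1 1) (RzOfRecord F N) (ZtOfRecord F N))) hk
    ((densitiesDescribed_leavesP_iff_sLaw₁₃CoPR_all_sepCoPR F N (⟨theta13LiveOfRecord F N, Zr⟩ : Stage13RParams F N) p w h hC).1 hD (k + 1) hk) s hΩ

/-- **★★★ … and from a non-vacuous N11 conjunct `Dag.B14_main (leavesP w p)` at that world** (in-edge leaves, small-field implication, flow control, interval hypothesis
read TRUE; the `rOperation` antecedent is the closed theorem `…LiveCoP.rOperation_leavesP_theta13LiveOfRecord_CoPR`). [cite: Balaban1988Convergent, Thm 1 p.262, (3.25) p.270, Theorem p.245, p.244, (3.16) p.268; Balaban1989LargeFieldI, (0.3)–(0.4) p.176] -/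
theorem sLaw₁₃CoPR_succ_clause_of_Omega_empty_of_b14_main_theta13LiveOfRecord_sepCoPR
    (hC : w.C = (datumOfRecord₁₃SepCoPR F N (⟨theta13LiveOfRecord F N, Zr⟩ : Stage13RParams F N) h).C)
    (hup : w.up p = upOfRecord₅C F N ((⟨theta13LiveOfRecord F N, Zr⟩ : Stage13RParams F N).toStage5₁₃CoPR F N) p) (h14 : Dag.B14_main (leavesP w p))
    (h7 : (leavesP w p).b7) (h8 : (leavesP w p).b8) (h9 : (leavesP w p).b9) (h10 : (leavesP w p).b10) (h11 : (leavesP w p).b11)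
    (hsf : (leavesP w p).smallCouplings → (leavesP w p).smallFieldInductive) (hfc : (leavesP w p).smallCouplings → (leavesP w p).flowControl)
    (hsc : (leavesP w p).smallCouplings) {k : ℕ} (hk : k < p.K)
    (s : SeqOfRecord F (theta13LiveOfRecord F N).ν (theta13LiveOfRecord F N).τ9.M (gOfRecord₁₃ F N (theta13LiveOfRecord F N) p) p.K (k + 1))
    (hΩ : s.Ω (k + 1) = ∅) :
    ∃ (t : SeqOfRecord F (theta13LiveOfRecord F N).ν (theta13LiveOfRecord F N).τ9.M (gOfRecord₁₃ F N (theta13LiveOfRecord F N) p) p.K (k + 1) →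
        Sect2.TermValues (F.P p.K) (MatA N) (FluctV N) (theta13LiveOfRecord F N).τ9.M)
      (Ek : SeqOfRecord F (theta13LiveOfRecord F N).ν (theta13LiveOfRecord F N).τ9.M (gOfRecord₁₃ F N (theta13LiveOfRecord F N) p) p.K (k + 1) → ℝ),
      Sect2.UniversalE t ∧
      (∀ s', Sect2.LawsRT (sect2TowerOfRecord F N (FluctV N) p.K (settingOfRecord₁₃ F N (theta13LiveOfRecord F N) p) ((theta13LiveOfRecord F N).Rz p.K) s' (t s'))
        (settingOfRecord₁₃ F N (theta13LiveOfRecord F N) p).lf (k + 1)) ∧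
      ((slotsTOfRecord F N (theta13LiveOfRecord F N).ν (theta13LiveOfRecord F N).τ9 (EOfRecord₁₃ F N (theta13LiveOfRecord F N))
          (wOfRecord₉ F N (theta13LiveOfRecord F N).toStage9Params) (theta13LiveOfRecord F N).ppSel p
          (gOfRecord₁₃ F N (theta13LiveOfRecord F N) p) (k + 1) s =ᵐ[fieldMeasure (F.P p.K) (k + 1) (SU N)] 0) ∨
        ∀ᵐ V' ∂fieldMeasure (F.P p.K) (k + 1) (SU N),
          slotsTOfRecord F N (theta13LiveOfRecord F N).ν (theta13LiveOfRecord F N).τ9 (EOfRecord₁₃ F N (theta13LiveOfRecord F N))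
              (wOfRecord₉ F N (theta13LiveOfRecord F N).toStage9Params) (theta13LiveOfRecord F N).ppSel p
              (gOfRecord₁₃ F N (theta13LiveOfRecord F N) p) (k + 1) s V' =
            sect2Slot F N (FluctV N) p.K (settingOfRecord₁₃ F N (theta13LiveOfRecord F N) p) ((theta13LiveOfRecord F N).Rz p.K)
              (WtOfRecord₁₃R F N (⟨theta13LiveOfRecord F N, Zr⟩ : Stage13RParams F N) p) s (t s) (Ek s)
              (UbgOfRecord₁₃CoP F N (theta13LiveOfRecord F N) p (k + 1) s) V') :=
  sLaw₁₃CoPR_succ_clause_of_Omega_empty_of_densitiesDescribed_theta13LiveOfRecord_sepCoPR F N Zr p w h hC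
    (h14 h7 h8 h9 h10 h11 hsf hfc (rOperation_leavesP_theta13LiveOfRecord_CoPR F N Zr p w hup) hsc) hk s hΩ

end ConverseFacesOfRecord

end Literature.MathematicalPhysics.QuantumFieldTheory.Balaban1983to89.B16RLeafRecord13SepCoPR
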